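import Literature.AlgebraicGeometry.Motives.CorrespondencesTransposeProofs
import HarnessLib

/-!
# Weil cohomology theories: more Künneth calculus (products and swaps of external products)

Formal consequences of the axioms of a Weil cohomology theory `W : WeilCohomology k K`
(`Literature.AlgebraicGeometry.Motives.WeilCohomology`, Kleiman 1968 §1.2) complementing the
Künneth tools of `CorrespondencesTransposeProofs` (`kunneth_induction`, `externalCup_apply`,
`transposeClass_externalCup`, …), for use in the Lefschetz trace formula and the calculus of
algebraic correspondences (Kleiman 1968 §1.3):

* vanishing above the top degree as an equation (`eq_zero_of_lt`), Koszul-sign bookkeeping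
  (`cast_negOnePow_mul`, `negOnePow_congr`);
* pull-backs of external products along maps into a product (`pullback_externalCup`) and the
  product of two external products (`cup_externalCup_externalCup`,
  `(pr₁* x ∪ pr₂* y) ∪ (pr₁* x' ∪ pr₂* y') = (-1)^{|y||x'|} pr₁* (x ∪ x') ∪ pr₂* (y ∪ y')`);
* traces of external products off the top bidegree vanish (`trace_externalCup_eq_zero`), and
  **the trace of `X × Y` is invariant under the swap** `Y × X ≅ X × Y`
  (`trace_cup_transposeClass`).

Everything here is a `theorem` with a real proof from the fields of `WeilCohomology` and the
discharged fact `IsSmoothProjective.tensor_holds` (`SegreEmbedding`); no new definitions.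

## References

* S. Kleiman, *Algebraic cycles and the Weil conjectures*, Dix exposés sur la cohomologie des
  schémas (1968), §1.2 (axioms (A), (B)), §1.3 (correspondences, `ᵗu = σ* u`).
-/

universe u v

open CategoryTheory AlgebraicGeometry MonoidalCategory CartesianMonoidalCategory Opposite
open scoped TensorProduct DirectSum

noncomputable section

namespace Literature.AlgebraicGeometry.Motives

namespace WeilCohomology

variable {k : Type u} [Field k] {K : Type v} [Field K] [CharZero K] (W : WeilCohomology k K)

section Basic

variable {n : ℕ} {X : SchemeOver k}

/-- Above the top degree every class vanishes: `Hⁱ(X) = 0` for `i > 2 dim X`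
(Kleiman 1968 §1.2 (A)). [cite: Kleiman1968AlgebraicCycles, §1.2 (A)] -/
theorem eq_zero_of_lt (hX : IsSmoothProjective n X) {i : ℕ} (hi : 2 * n < i) (x : W.obj X i) :
    x = 0 :=
  haveI := W.subsingleton_obj hX hi
  Subsingleton.elim _ _

/-- The cup-product pairing is `(x, y) ↦ tr (x ∪ y)`. [folklore] -/
@[simp]
theorem cupPairing_apply (n i j : ℕ) (h : i + j = 2 * n) (x : W.obj X i) (y : W.obj X j) :
    W.cupPairing X n i j h x y = W.trace X n (W.cup h x y) := rfl

end Basic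

section Kunneth

variable {n m : ℕ} {X Y : SchemeOver k}

/-- Pull-back of an external product along a map into the product:
`f* (pr₁* x ∪ pr₂* y) = (f ≫ pr₁)* x ∪ (f ≫ pr₂)* y`. [folklore] -/
theorem pullback_externalCup {t nm : ℕ} {T : SchemeOver k} (hT : IsSmoothProjective t T)
    (hXY : IsSmoothProjective nm (X ⊗ Y)) (f : T ⟶ X ⊗ Y) {i j d : ℕ} (h : i + j = d)
    (x : W.obj X i) (y : W.obj Y j) :
    W.pullback f d (W.externalCup X Y h x y) =
      W.cup h (W.pullback (f ≫ fst X Y) i x) (W.pullback (f ≫ snd X Y) j y) := by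
  rw [externalCup_apply, W.map_cup hT hXY f h, W.pullback_comp, W.pullback_comp]
  rfl


/-- Products of smooth projective varieties are smooth projective (the discharged fact
`IsSmoothProjective.tensor`, Segre embedding), in the form used throughout this file. [cite: Hartshorne1977, II Ex. 5.11 and III.10.1] -/
theorem isSmoothProjective_tensor (hX : IsSmoothProjective n X) (hY : IsSmoothProjective m Y) :
    IsSmoothProjective (n + m) (X ⊗ Y) :=
  IsSmoothProjective.tensor_holds hX hY

omit [CharZero K] in
/-- Product of two Koszul signs, as scalars of `K`. [folklore] -/
theorem cast_negOnePow_mul (a b : ℤ) :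
    ((a.negOnePow : ℤ) : K) * ((b.negOnePow : ℤ) : K) = (((a + b).negOnePow : ℤ) : K) := by
  rw [Int.negOnePow_add, Units.val_mul, Int.cast_mul]

/-- Two Koszul signs agree when the exponents have the same parity. [folklore] -/
theorem negOnePow_congr {a b : ℤ} (h : Even (a - b)) : a.negOnePow = b.negOnePow :=
  (Int.negOnePow_eq_iff a b).mpr h

/-- The product of two external products:
`(pr₁* x ∪ pr₂* y) ∪ (pr₁* x' ∪ pr₂* y') = (-1)^{|y| |x'|} pr₁* (x ∪ x') ∪ pr₂* (y ∪ y')`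
(graded commutativity on `X × Y`). [folklore] -/
theorem cup_externalCup_externalCup (hX : IsSmoothProjective n X) (hY : IsSmoothProjective m Y)
    {i j i' j' d d' e p q : ℕ} (h₁ : i + j = d) (h₂ : i' + j' = d') (h : d + d' = e)
    (hp : i + i' = p) (hq : j + j' = q) (h' : p + q = e)
    (x : W.obj X i) (y : W.obj Y j) (x' : W.obj X i') (y' : W.obj Y j') :
    W.cup h (W.externalCup X Y h₁ x y) (W.externalCup X Y h₂ x' y') =
      ((j * i' : ℤ).negOnePow : ℤ) • W.externalCup X Y h' (W.cup hp x x') (W.cup hq y y') := by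
  have hXY := isSmoothProjective_tensor hX hY
  simp only [externalCup_apply]
  set a := W.pullback (fst X Y) i x
  set b := W.pullback (snd X Y) j y
  set a' := W.pullback (fst X Y) i' x'
  set b' := W.pullback (snd X Y) j' y'
  rw [W.cup_assoc hXY h₁ (show j + d' = j + d' from rfl) h (by omega) a b (W.cup h₂ a' b'),
    ← W.cup_assoc hXY (show j + i' = j + i' from rfl) h₂ (by omega : j + i' + j' = j + d') rfl b a' b',
    W.cup_comm hXY (show j + i' = j + i' from rfl) (by omega : i' + j = j + i') b a',
    ← Int.cast_smul_eq_zsmul K, LinearMap.map_smul₂, LinearMap.map_smul,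
    W.cup_assoc hXY (by omega : i' + j = j + i') hq (by omega : j + i' + j' = j + d')
      (by omega : i' + q = j + d') a' b b',
    ← W.cup_assoc hXY hp (by omega : i' + q = j + d') h' (by omega) a a',
    W.map_cup hXY hX (fst X Y) hp, W.map_cup hXY hY (snd X Y) hq, Int.cast_smul_eq_zsmul]

/-- Off the top bidegree the trace of an external product vanishes: for `x ∈ Hⁱ(X)`, `y ∈ Hʲ(Y)`
with `i + j = 2 (dim X + dim Y)` but `i ≠ 2 dim X`, `tr_{X×Y} (pr₁* x ∪ pr₂* y) = 0` (one of
`x`, `y` sits above the top degree). [folklore] -/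
theorem trace_externalCup_eq_zero (hX : IsSmoothProjective n X) (hY : IsSmoothProjective m Y)
    {i j : ℕ} (h : i + j = 2 * (n + m)) (hi : i ≠ 2 * n) (x : W.obj X i) (y : W.obj Y j) :
    W.trace (X ⊗ Y) (n + m) (W.externalCup X Y h x y) = 0 := by
  rw [W.externalCup_eq_zero_of_ne hX hY h hi, map_zero]

/-- The transpose of a correspondence is the pull-back along the swap. [folklore] -/
theorem transposeClass_apply {d : ℕ} (u : W.obj (X ⊗ Y) d) :
    W.transposeClass u = W.pullback (β_ Y X).hom d u := rfl

/-- **The trace of `X × Y` is invariant under the swap** `σ : Y × X ≅ X × Y`: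
`tr_{Y×X} (σ* a ∪ σ* b) = tr_{X×Y} (a ∪ b)` (from Künneth (B) and the multiplicativity of the
trace; the sign `(-1)^{(2 dim X)(2 dim Y)}` is `+1`). [cite: Kleiman1968AlgebraicCycles, §1.2 (B) and §1.3] -/
theorem trace_cup_transposeClass (hX : IsSmoothProjective n X) (hY : IsSmoothProjective m Y)
    {i j : ℕ} (h₁ : i + j = 2 * (n + m)) (h₂ : i + j = 2 * (m + n)) (a : W.obj (X ⊗ Y) i)
    (b : W.obj (X ⊗ Y) j) :
    W.trace (Y ⊗ X) (m + n) (W.cup h₂ (W.transposeClass a) (W.transposeClass b)) =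
      W.trace (X ⊗ Y) (n + m) (W.cup h₁ a b) := by
  induction a using W.kunneth_induction hX hY generalizing b with
  | zero => simp [transposeClass_apply]
  | add a a' ha ha' =>
    simp only [transposeClass_apply] at ha ha' ⊢
    simp only [map_add, LinearMap.add_apply, ha, ha']
  | ext i₁ j₁ hij x y =>
    induction b using W.kunneth_induction hX hY with
    | zero => simp [transposeClass_apply]
    | add b b' hb hb' =>
      simp only [transposeClass_apply] at hb hb' ⊢
      simp only [map_add, hb, hb']
    | ext i₂ j₂ hij' x' y' =>
      rw [W.transposeClass_externalCup hX hY hij (by omega) x y,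
        W.transposeClass_externalCup hX hY hij' (by omega) x' y', ← Int.cast_smul_eq_zsmul K,
        ← Int.cast_smul_eq_zsmul K, LinearMap.map_smul₂, LinearMap.map_smul, map_smul, map_smul]
      by_cases htop : i₁ + i₂ = 2 * n
      · rw [W.cup_externalCup_externalCup hY hX (by omega) (by omega) h₂ (show j₁ + j₂ = 2 * m by omega)
            htop (by omega) y x y' x',
          W.cup_externalCup_externalCup hX hY hij hij' h₁ htop (show j₁ + j₂ = 2 * m by omega)
            (by omega) x y x' y', ← Int.cast_smul_eq_zsmul K, ← Int.cast_smul_eq_zsmul K, map_smul,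
          map_smul, W.trace_externalCup hY hX, W.trace_externalCup hX hY, mul_comm (W.trace Y m _),
          smul_smul, smul_smul, cast_negOnePow_mul, cast_negOnePow_mul]
        congr 3
        refine negOnePow_congr ⟨i₁ * j₁ + 2 * n * m - 2 * n * j₁, ?_⟩
        have e₁ : (i₂ : ℤ) = 2 * n - i₁ := by omega
        have e₂ : (j₂ : ℤ) = 2 * m - j₁ := by omega
        rw [e₁, e₂]; ring
      · rw [W.cup_externalCup_externalCup hY hX (by omega) (by omega) h₂ rfl rfl (by omega) y x y' x',
          W.cup_externalCup_externalCup hX hY hij hij' h₁ rfl rfl (by omega) x y x' y',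
          ← Int.cast_smul_eq_zsmul K, ← Int.cast_smul_eq_zsmul K, map_smul, map_smul,
          W.trace_externalCup_eq_zero hY hX _ (by omega : j₁ + j₂ ≠ 2 * m),
          W.trace_externalCup_eq_zero hX hY _ htop]
        simp

end Kunneth

end WeilCohomology

end Literature.AlgebraicGeometry.Motives

end
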